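import Summits.QuantumFields.YangMills.Theorems.SmallCircleAnchorAnchorGapFrozenWellPosed
import Summits.QuantumFields.YangMills.Theorems.SmallCircleAnchorAnchorGapGaugeAveraging
import Summits.QuantumFields.YangMills.Theorems.SmallCircleAnchorAnchorGapGaugeCovariance

/-!
# Elitzur reduction for the pinned finite-temperature Wilson theory of crux `AnchorGap`

Helper for crux stmt-QuantumFields-11141 (`AnchorGap`, route `SmallCircleAnchor`), line
independent: `clustering_of_gaugeInvariant` — in the crux's inline vocabulary (verbatim
`let`-chain, `V` a continuous class function, arbitrary schedule value `E β` and coupling `β`),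
volume-uniform exponential clustering of all GAUGE-INVARIANT bounded `w`-local observables at
rate `m` with constant `C` implies the same for ALL bounded `w`-local observables with constant
`max C (2 e^{m(w+1)})` (registered sub-goal). Every proof of the crux body may therefore restrict
attention to gauge-invariant observables (Wilson loops, plaquette and Polyakov-line class
functions). Ingredients: gauge invariance of product Haar and of the pinned weight, Haar averaging
over all gauge transformations (Osterwalder–Seiler), factorisation of the joint average for
separations `n > w + 1` (disjoint gauge supports, using `2n < L`), and the covariance bound `2`
for `n ≤ w + 1`.
-/

set_option autoImplicit false

noncomputable section

namespace Summit.QuantumFields.YangMills.Theorems.AnchorGap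

open MeasureTheory
open Literature.MathematicalPhysics.QuantumFieldTheory

namespace GaugeAvg

open Summit.QuantumFields.QCD.Cruxes.RobustYangMillsRG.Birth.GaugeAveraging (pi_integral_comp_equiv)

/-! ### Elitzur reduction: clustering of gauge-invariant local observables suffices -/

section Reduction

/-- **Reduction of volume-uniform clustering to the gauge-invariant sector** (crux `AnchorGap`
vocabulary, verbatim `let`-chain; `V` a continuous class function, `E`, `β` arbitrary). If at
given `(β, m, w, C, L)` the `E(β)V`-pinned finite-temperature Wilson expectation clusters at rate
`m` with constant `C` for all pairs of GAUGE-INVARIANT `w`-local bounded measurable observables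
(all base points `c`, all separations `2n < L`), then it clusters for ALL `w`-local bounded
measurable observables, at the same rate, with constant `max C (2 e^{m (w+1)})`. Proof
(Osterwalder–Seiler gauge averaging): the weight and product Haar are gauge invariant, so every
expectation is unchanged by replacing an observable by its Haar average over all gauge
transformations (`integral_haarAvg_mul`), which is gauge invariant, measurable, bounded by `1`
and supported on the same links; for `n > w + 1` the gauge supports (cube enlarged by one) of
`F₁` and `F₂ ∘ σ_n` are disjoint (`not_mem_cube_of_translate`, using `2n < L`), so the average
of the product factorises (`haarAvg_mul_comp`) and the hypothesis applies to the averages; for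
`n ≤ w + 1` the covariance is at most `2 ≤ 2 e^{m(w+1)} e^{-m n}`. [folklore] -/
theorem clustering_of_gaugeInvariant :
    ∀ (G : Type) [Group G] [TopologicalSpace G] [IsTopologicalGroup G] [CompactSpace G], letI : MeasurableSpace G := borel G; haveI : BorelSpace G := ⟨rfl⟩; ∀ (r : LatticeRep G) (V : G → ℝ), (∀ a g : G, V (a * g * a⁻¹) = V g) → Continuous V → ∀ (E : ℝ → ℝ) (T : ℕ) [NeZero T] (β m : ℝ), 0 ≤ m → ∀ (w : ℕ) (C : ℝ) (L : ℕ) [NeZero L], let St := ZMod T × (Fin 3 → ZMod L); let Cfg := St × Option (Fin 3) → G; let ν : MeasureTheory.Measure Cfg := MeasureTheory.Measure.pi fun _ => haarProbability G; let sh : St → Option (Fin 3) → St := fun x μ => Option.elim μ (x.1 + 1, x.2) fun i => (x.1, x.2 + Pi.single i 1); let pl : Cfg → St → Option (Fin 3) → Option (Fin 3) → G := fun U x μ κ => U (x, μ) * U (sh x μ, κ) * (U (sh x κ, μ))⁻¹ * (U (x, κ))⁻¹; let act : Cfg → ℝ := fun U => β * ∑ x : St, ∑ i : Fin 3, (r.ρ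 (pl U x none (some i))).trace.re + β * ∑ x : St, ∑ q : {q : Fin 3 × Fin 3 // q.1 < q.2}, (r.ρ (pl U x (some q.1.1) (some q.1.2))).trace.re; let P : Cfg → (Fin 3 → ZMod L) → G := fun U x => (List.ofFn fun t : Fin T => U ((((t : ℕ) : ZMod T), x), none)).prod; let wgt : Cfg → ℝ := fun U => Real.exp (act U - E β * ∑ x : Fin 3 → ZMod L, V (P U x)); let Ex : (Cfg → ℝ) → ℝ := fun F => (∫ U, F U * wgt U ∂ν) / (∫ U, wgt U ∂ν); let σ : ℕ → Cfg → Cfg := fun n U p => U ((p.1.1, p.1.2 + Pi.single 0 (n : ZMod L)), p.2); let gauge : (St → G) → Cfg → Cfg := fun h U p => h p.1 * U p * (h (sh p.1 p.2))⁻¹; (∀ (c : Fin 3 → ZMod L), let Loc := fun F : Cfg → ℝ => Measurable F ∧ (∀ U, |F U| ≤ 1) ∧ ∀ U U', (∀ p, (∀ i : Fin 3, (p.1.2 i - c i).val ≤ w) → U p = U' p) → F U = F U'; ∀ F₁ F₂ : Cfg → ℝ, Loc F₁ → Loc F₂ → (∀ (h : St → G) (U : Cfg), F₁ (gauge h U)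 = F₁ U) → (∀ (h : St → G) (U : Cfg), F₂ (gauge h U) = F₂ U) → ∀ n : ℕ, 2 * n < L → |Ex (fun U => F₁ U * F₂ (σ n U)) - Ex F₁ * Ex (fun U => F₂ (σ n U))| ≤ C * Real.exp (-(m * n))) → ∀ (c : Fin 3 → ZMod L), let Loc := fun F : Cfg → ℝ => Measurable F ∧ (∀ U, |F U| ≤ 1) ∧ ∀ U U', (∀ p, (∀ i : Fin 3, (p.1.2 i - c i).val ≤ w) → U p = U' p) → F U = F U'; ∀ F₁ F₂ : Cfg → ℝ, Loc F₁ → Loc F₂ → ∀ n : ℕ, 2 * n < L → |Ex (fun U => F₁ U * F₂ (σ n U)) - Ex F₁ * Ex (fun U => F₂ (σ n U))| ≤ max C (2 * Real.exp (m * (w + 1))) * Real.exp (-(m * n)) := by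
  intro G _ _ _ _
  letI : MeasurableSpace G := borel G
  haveI : BorelSpace G := ⟨rfl⟩
  intro r V hVcl hVc E T _ β m hm w C L _ St Cfg ν sh pl act P wgt Ex σ gauge hGI c Loc F₁ F₂ hF₁ hF₂
    n hn
  haveI : SecondCountableTopology G :=
    (r.continuous.isClosedEmbedding r.injective).isEmbedding.secondCountableTopology
  haveI hν : IsProbabilityMeasure ν := by
    show IsProbabilityMeasure (Measure.pi fun _ : St × Option (Fin 3) => haarProbability G)
    infer_instance
  have hgauge : ∀ (h : St → G) (U : Cfg) (p : St × Option (Fin 3)),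
      gauge h U p = h p.1 * U p * (h (sh p.1 p.2))⁻¹ := fun _ _ _ => rfl
  /- 1. the weight: measurable, pinched, gauge invariant -/
  have hwginv : ∀ (h : St → G) (U : Cfg), wgt (gauge h U) = wgt U :=
    soft_weight_gauge_invariant G r V hVcl E T β L
  have hplc : ∀ (x : St) (μ κ : Option (Fin 3)), Continuous fun U : Cfg => pl U x μ κ := by
    intro x μ κ
    show Continuous fun U : Cfg => U (x, μ) * U (sh x μ, κ) * (U (sh x κ, μ))⁻¹ * (U (x, κ))⁻¹
    exact (((continuous_apply (x, μ)).mul (continuous_apply (sh x μ, κ))).mul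
      (continuous_apply (sh x κ, μ)).inv).mul (continuous_apply (x, κ)).inv
  have htrc : ∀ (x : St) (μ κ : Option (Fin 3)),
      Continuous fun U : Cfg => (r.ρ (pl U x μ κ)).trace.re := fun x μ κ =>
    Complex.continuous_re.comp ((r.continuous.comp (hplc x μ κ)).matrix_trace)
  have hactc : Continuous act := by
    refine (continuous_const.mul (continuous_finsetSum _ fun x _ =>
      continuous_finsetSum _ fun i _ => htrc x none (some i))).add
      (continuous_const.mul (continuous_finsetSum _ fun x _ =>
        continuous_finsetSum _ fun q _ => htrc x (some q.1.1) (some q.1.2)))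
  have hPc : ∀ x : Fin 3 → ZMod L, Continuous fun U : Cfg => P U x := by
    intro x
    show Continuous fun U : Cfg => (List.ofFn fun t : Fin T => U ((((t : ℕ) : ZMod T), x), none)).prod
    simp only [List.ofFn_eq_map]
    exact continuous_list_prod _ fun t _ => continuous_apply _
  have hwc : Continuous wgt :=
    Real.continuous_exp.comp (hactc.sub (continuous_const.mul
      (continuous_finsetSum _ fun x _ => hVc.comp (hPc x))))
  have hwm : Measurable wgt := hwc.measurable
  -- bounds
  obtain ⟨g₁, -, hg₁⟩ := isCompact_univ.exists_isMaxOn Set.univ_nonempty hVc.continuousOn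
  obtain ⟨g₂, -, hg₂⟩ := isCompact_univ.exists_isMinOn Set.univ_nonempty hVc.continuousOn
  set Vb : ℝ := max |V g₁| |V g₂| with hVb
  have hVabs : ∀ g : G, |V g| ≤ Vb := by
    intro g
    have h1 : V g ≤ V g₁ := hg₁ (Set.mem_univ g)
    have h2 : V g₂ ≤ V g := hg₂ (Set.mem_univ g)
    rw [abs_le]
    constructor
    · have : -Vb ≤ -|V g₂| := by simp [hVb]
      linarith [neg_abs_le (V g₂)]
    · exact h1.trans ((le_abs_self _).trans (le_max_left _ _))
  set B : ℝ := |β| * ∑ _x : St, ∑ _i : Fin 3, (r.N : ℝ) +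
    |β| * ∑ _x : St, ∑ _q : {q : Fin 3 × Fin 3 // q.1 < q.2}, (r.N : ℝ) +
    |E β| * ∑ _x : Fin 3 → ZMod L, Vb with hB
  have hexpb : ∀ U : Cfg, |act U - E β * ∑ x : Fin 3 → ZMod L, V (P U x)| ≤ B := by
    intro U
    have h1 : |∑ x : St, ∑ i : Fin 3, (r.ρ (pl U x none (some i))).trace.re| ≤
        ∑ _x : St, ∑ _i : Fin 3, (r.N : ℝ) := by
      refine (Finset.abs_sum_le_sum_abs _ _).trans (Finset.sum_le_sum fun x _ => ?_)
      exact (Finset.abs_sum_le_sum_abs _ _).trans (Finset.sum_le_sum fun i _ =>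
        abs_trace_re_le G r _)
    have h2 : |∑ x : St, ∑ q : {q : Fin 3 × Fin 3 // q.1 < q.2},
        (r.ρ (pl U x (some q.1.1) (some q.1.2))).trace.re| ≤
        ∑ _x : St, ∑ _q : {q : Fin 3 × Fin 3 // q.1 < q.2}, (r.N : ℝ) := by
      refine (Finset.abs_sum_le_sum_abs _ _).trans (Finset.sum_le_sum fun x _ => ?_)
      exact (Finset.abs_sum_le_sum_abs _ _).trans (Finset.sum_le_sum fun q _ =>
        abs_trace_re_le G r _)
    have h3 : |∑ x : Fin 3 → ZMod L, V (P U x)| ≤ ∑ _x : Fin 3 → ZMod L, Vb :=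
      (Finset.abs_sum_le_sum_abs _ _).trans (Finset.sum_le_sum fun x _ => hVabs _)
    calc |act U - E β * ∑ x : Fin 3 → ZMod L, V (P U x)|
        ≤ |act U| + |E β * ∑ x : Fin 3 → ZMod L, V (P U x)| := abs_sub _ _
      _ ≤ (|β * ∑ x : St, ∑ i : Fin 3, (r.ρ (pl U x none (some i))).trace.re| +
          |β * ∑ x : St, ∑ q : {q : Fin 3 × Fin 3 // q.1 < q.2},
            (r.ρ (pl U x (some q.1.1) (some q.1.2))).trace.re|) +
          |E β * ∑ x : Fin 3 → ZMod L, V (P U x)| := by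
          gcongr; exact abs_add_le _ _
      _ ≤ B := by
          rw [abs_mul, abs_mul, abs_mul, hB]
          exact add_le_add (add_le_add (mul_le_mul_of_nonneg_left h1 (abs_nonneg β))
            (mul_le_mul_of_nonneg_left h2 (abs_nonneg β)))
            (mul_le_mul_of_nonneg_left h3 (abs_nonneg _))
  have hwa : ∀ U : Cfg, Real.exp (-B) ≤ wgt U := by
    intro U
    have h1 := neg_abs_le (act U - E β * ∑ x : Fin 3 → ZMod L, V (P U x))
    have h2 := hexpb U
    exact Real.exp_le_exp.2 (by linarith)
  have hwb : ∀ U : Cfg, wgt U ≤ Real.exp B := by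
    intro U
    have h1 := le_abs_self (act U - E β * ∑ x : Fin 3 → ZMod L, V (P U x))
    have h2 := hexpb U
    exact Real.exp_le_exp.2 (by linarith)
  have hwi : Integrable wgt ν :=
    integrable_of_abs_le ν hwm (c := Real.exp B) fun U => by
      rw [abs_of_nonneg ((Real.exp_pos (-B)).le.trans (hwa U))]; exact hwb U
  /- 2. the observables and their Haar averages -/
  obtain ⟨hF₁m, hF₁b, hF₁d⟩ := hF₁
  obtain ⟨hF₂m, hF₂b, hF₂d⟩ := hF₂
  set Sw : Set (St × Option (Fin 3)) := {p | ∀ i : Fin 3, (p.1.2 i - c i).val ≤ w} with hSw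
  have hd₁ : DependsOn F₁ Sw := fun U U' h => hF₁d U U' fun p hp => h p hp
  have hd₂ : DependsOn F₂ Sw := fun U U' h => hF₂d U U' fun p hp => h p hp
  set πG : Measure (St → G) := Measure.pi fun _ : St => haarProbability G with hπG
  set A₁ : Cfg → ℝ := fun U => ∫ h, F₁ (gauge h U) ∂πG with hA₁
  set A₂ : Cfg → ℝ := fun U => ∫ h, F₂ (gauge h U) ∂πG with hA₂
  have hA₁m : Measurable A₁ := measurable_haarAvg sh gauge hgauge hF₁m
  have hA₂m : Measurable A₂ := measurable_haarAvg sh gauge hgauge hF₂m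
  have hA₁b : ∀ U, |A₁ U| ≤ 1 := abs_haarAvg_le gauge hF₁b
  have hA₂b : ∀ U, |A₂ U| ≤ 1 := abs_haarAvg_le gauge hF₂b
  have hA₁d : DependsOn A₁ Sw := dependsOn_haarAvg sh gauge hgauge hd₁ πG
  have hA₂d : DependsOn A₂ Sw := dependsOn_haarAvg sh gauge hgauge hd₂ πG
  have hA₁g : ∀ (h : St → G) (U : Cfg), A₁ (gauge h U) = A₁ U :=
    fun h U => haarAvg_gauge sh gauge hgauge F₁ h U
  have hA₂g : ∀ (h : St → G) (U : Cfg), A₂ (gauge h U) = A₂ U :=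
    fun h U => haarAvg_gauge sh gauge hgauge F₂ h U
  have hLoc₁ : Loc A₁ := ⟨hA₁m, hA₁b, fun U U' h => hA₁d fun p hp => h p hp⟩
  have hLoc₂ : Loc A₂ := ⟨hA₂m, hA₂b, fun U U' h => hA₂d fun p hp => h p hp⟩
  /- 3. the hypothesis for the averages -/
  have key := hGI c A₁ A₂ hLoc₁ hLoc₂ hA₁g hA₂g n hn
  /- 4. small separations -/
  have hσm : Measurable (σ n) := measurable_pi_lambda _ fun p => measurable_pi_apply _
  by_cases hwn : w + 1 < n
  swap
  · have hnw : n ≤ w + 1 := Nat.le_of_not_lt hwn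
    have h2 := ratioEx_cov_abs_le_two ν (Real.exp_pos (-B)) hwm hwa hwb hF₁m hF₁b (hF₂m.comp hσm)
      fun U => hF₂b (σ n U)
    have hexp : (1 : ℝ) ≤ Real.exp (m * (w + 1)) * Real.exp (-(m * n)) := by
      rw [← Real.exp_add]
      refine Real.one_le_exp ?_
      have : (n : ℝ) ≤ w + 1 := by exact_mod_cast hnw
      nlinarith
    calc |Ex (fun U => F₁ U * F₂ (σ n U)) - Ex F₁ * Ex (fun U => F₂ (σ n U))| ≤ 2 := h2
      _ ≤ 2 * (Real.exp (m * (w + 1)) * Real.exp (-(m * n))) := by nlinarith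
      _ = (2 * Real.exp (m * (w + 1))) * Real.exp (-(m * n)) := by ring
      _ ≤ max C (2 * Real.exp (m * (w + 1))) * Real.exp (-(m * n)) := by
          gcongr; exact le_max_right _ _
  /- 5. large separations: replace the observables by their averages -/
  -- the spatial translation by `n e₀` as a site bijection commuting with the shifts
  set v : Fin 3 → ZMod L := Pi.single 0 (n : ZMod L) with hv
  let τ : St ≃ St :=
    { toFun := fun x => (x.1, x.2 + v)
      invFun := fun x => (x.1, x.2 - v)
      left_inv := fun x => by simp
      right_inv := fun x => by simp }
  have hτ : ∀ (x : St) (μ : Option (Fin 3)), τ (sh x μ) = sh (τ x) μ := by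
    rintro ⟨s, y⟩ (_ | i)
    · rfl
    · show ((s, y + Pi.single i 1 + v) : St) = (s, y + v + Pi.single i 1)
      rw [add_right_comm]
  have hστ : ∀ U : Cfg, σ n U = fun p => U (τ p.1, p.2) := fun U => rfl
  -- gauge supports
  set Q : Set St := {x | ∀ i : Fin 3, (x.2 i - c i).val ≤ w + 1} with hQ
  have hQ₁ : ∀ p ∈ Sw, p.1 ∈ Q ∧ sh p.1 p.2 ∈ Q := fun p hp => endpoints_mem_cube c p.1 p.2 hp
  have hdisj : ∀ x ∈ Q, τ x ∉ Q := fun x hx => not_mem_cube_of_translate hwn hn c x hx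
  -- (a) the joint expectation
  have hprod : ∀ U : Cfg, (∫ h, F₁ (gauge h U) * F₂ (σ n (gauge h U)) ∂πG) = A₁ U * A₂ (σ n U) := by
    intro U
    simp only [hστ, hA₁, hA₂]
    exact haarAvg_mul_comp sh gauge hgauge τ hτ hQ₁ hQ₁ hdisj hF₁m hF₂m hd₁ hd₂ U
  have hnum : ∫ U, (F₁ U * F₂ (σ n U)) * wgt U ∂ν = ∫ U, (A₁ U * A₂ (σ n U)) * wgt U ∂ν := by
    have hm12 : Measurable fun U : Cfg => F₁ U * F₂ (σ n U) := hF₁m.mul (hF₂m.comp hσm)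
    have hb12 : ∀ U : Cfg, |F₁ U * F₂ (σ n U)| ≤ 1 := fun U => by
      rw [abs_mul]
      calc |F₁ U| * |F₂ (σ n U)| ≤ 1 * 1 :=
            mul_le_mul (hF₁b U) (hF₂b _) (abs_nonneg _) zero_le_one
        _ = 1 := one_mul (1 : ℝ)
    rw [← integral_haarAvg_mul sh gauge hgauge hwm hwi hwginv hm12 hb12]
    congr 1
    funext U
    congr 1
    exact hprod U
  have hnum₁ : ∫ U, F₁ U * wgt U ∂ν = ∫ U, A₁ U * wgt U ∂ν :=
    (integral_haarAvg_mul sh gauge hgauge hwm hwi hwginv hF₁m hF₁b).symm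
  have havg₂ : ∀ U : Cfg, (∫ h, F₂ (σ n (gauge h U)) ∂πG) = A₂ (σ n U) := by
    intro U
    simp only [hστ, hA₂]
    simp only [comp_gauge_of_comm sh gauge hgauge τ hτ]
    exact pi_integral_comp_equiv (haarProbability G) τ (fun h => F₂ (gauge h fun p => U (τ p.1, p.2)))
  have hnum₂ : ∫ U, F₂ (σ n U) * wgt U ∂ν = ∫ U, A₂ (σ n U) * wgt U ∂ν := by
    have hm2 : Measurable fun U : Cfg => F₂ (σ n U) := hF₂m.comp hσm
    have hb2 : ∀ U : Cfg, |F₂ (σ n U)| ≤ 1 := fun U => hF₂b (σ n U)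
    rw [← integral_haarAvg_mul sh gauge hgauge hwm hwi hwginv hm2 hb2]
    congr 1
    funext U
    congr 1
    exact havg₂ U
  have hEx : Ex (fun U => F₁ U * F₂ (σ n U)) = Ex (fun U => A₁ U * A₂ (σ n U)) := by
    show (∫ U, (F₁ U * F₂ (σ n U)) * wgt U ∂ν) / (∫ U, wgt U ∂ν) =
      (∫ U, (A₁ U * A₂ (σ n U)) * wgt U ∂ν) / (∫ U, wgt U ∂ν)
    rw [hnum]
  have hEx₁ : Ex F₁ = Ex A₁ := by
    show (∫ U, F₁ U * wgt U ∂ν) / (∫ U, wgt U ∂ν) = (∫ U, A₁ U * wgt U ∂ν) / (∫ U, wgt U ∂ν)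
    rw [hnum₁]
  have hEx₂ : Ex (fun U => F₂ (σ n U)) = Ex (fun U => A₂ (σ n U)) := by
    show (∫ U, F₂ (σ n U) * wgt U ∂ν) / (∫ U, wgt U ∂ν) = (∫ U, A₂ (σ n U) * wgt U ∂ν) / (∫ U, wgt U ∂ν)
    rw [hnum₂]
  rw [hEx, hEx₁, hEx₂]
  calc |Ex (fun U => A₁ U * A₂ (σ n U)) - Ex A₁ * Ex (fun U => A₂ (σ n U))|
      ≤ C * Real.exp (-(m * n)) := key
    _ ≤ max C (2 * Real.exp (m * (w + 1))) * Real.exp (-(m * n)) := by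
        gcongr; exact le_max_left _ _

end Reduction

end GaugeAvg

end Summit.QuantumFields.YangMills.Theorems.AnchorGap

end
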